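import Summits.Ventures.PercRepro.HyperplaneKeySix

/-!
# PercRepro — THE HYPERPLANE KEY, SHARPENED ON THE `A`-SIDE: RANK-`j` SETS COUNTED FLAT BY FLAT (p1, gen 43; S3 feeder —
p8 owns SUBCLAIM-S3; no window claim here)

`HyperplaneKeyCount` charges every independent `j`-set `I` with its whole fibre `{X : I ⊆ X ⊆ cl I}` — `2^{f(j) − j}` sets,
so a rank-`j` set `X` is counted once per basis of `X`. Counting by FLATS instead: every set of rank `j` lies in the
powerset of its closure, a rank-`j` flat `F` of `≤ f(j)` points, and `F` has at least `∏_{i<j} max(|F| − f(i), 1) / j!`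
independent `j`-subsets (THE GREEDY COUNT: the `i`-th element of an ordered basis of `F` avoids the closure of the first
`i`, a set of `≤ f(i)` points, and `F` is not spanned by `i < j` elements). Hence `2^{|F|} ≤ g_j · #bases(F)` whenever
`j!·2^s ≤ g_j · ∏_{i<j} max(s − f(i), 1)` for every `j ≤ s ≤ f(j)`, and summing over the flats,
`#{X : ρ(X) = j} ≤ Σ_F 2^{|F|} ≤ g_j · #{independent j-sets} ≤ g_j · C(n, j)`.

* `card_indepSets_mul_le` — the greedy step on `F.powerset.filter (Indep ∧ card = i)`, the independent `i`-subsets of `F`: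
  `m · #indepSets_i ≤ (i + 1) · #indepSets_{i+1}`; `card_filter_notMem_closure_ge` — the `≥ max(|F| − f(i), 1)` extensions;
  `prod_le_factorial_mul_card_indepSets` — `∏_{i<r} max(|F| − f(i), 1) ≤ r! · #indepSets_r`.
* `ncard_eRk_le_le_sum_choose_flats` — **the flat-by-flat count** `#{X ⊆ E : ρ(X) ≤ q} ≤ Σ_{j ≤ q} C(n, j) · g_j`.
* `rls_of_hyperplane_key_two_base_weighted` — the key from a weighted count and two base values.
Axioms: standard.
-/

open scoped Matroid

namespace PercRepro

namespace HypKey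

open Set Finset Classical

variable {α : Type}

/-- Membership in the finset of independent `i`-subsets of `F`. -/
theorem mem_indepSets {M : Matroid α} {F : Finset α} {i : ℕ} {I : Finset α} :
    I ∈ (F.powerset.filter (fun I : Finset α => M.Indep (↑I : Set α) ∧ I.card = i)) ↔ I ⊆ F ∧ M.Indep (↑I : Set α) ∧ I.card = i := by
  simp only [Finset.mem_filter, Finset.mem_powerset]

/-- `(F.powerset.filter (fun I : Finset α => M.Indep (↑I : Set α) ∧ I.card = 0)) = {∅}`. -/
theorem indepSets_zero (M : Matroid α) (F : Finset α) : (F.powerset.filter (fun I : Finset α => M.Indep (↑I : Set α) ∧ I.card = 0)) = {∅} := by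
  ext I
  rw [mem_indepSets, Finset.mem_singleton, Finset.card_eq_zero]
  constructor
  · rintro ⟨-, -, h⟩
    exact h
  · rintro rfl
    exact ⟨Finset.empty_subset _, by simp, rfl⟩

/-- **THE GREEDY STEP.** If every independent `i`-subset `I` of `F` has at least `m` extensions `x ∈ F ∖ cl I`, then
`m · #indepSets_i ≤ (i + 1) · #indepSets_{i+1}`: the pairs `(I, x)` map onto independent `(i+1)`-subsets `insert x I`,
and the fibre over `J` injects into `J`. -/
theorem card_indepSets_mul_le (M : Matroid α) (F : Finset α) (hF : (↑F : Set α) ⊆ M.E) (i m : ℕ)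
    (hm : ∀ I ∈ (F.powerset.filter (fun I : Finset α => M.Indep (↑I : Set α) ∧ I.card = i)), m ≤ (F.filter (fun x => x ∉ M.closure (↑I : Set α))).card) :
    m * ((F.powerset.filter (fun I : Finset α => M.Indep (↑I : Set α) ∧ I.card = i))).card ≤ (i + 1) * ((F.powerset.filter (fun I : Finset α => M.Indep (↑I : Set α) ∧ I.card = (i + 1)))).card := by
  set P : Finset (Σ _ : Finset α, α) :=
    ((F.powerset.filter (fun I : Finset α => M.Indep (↑I : Set α) ∧ I.card = i))).sigma (fun I => F.filter (fun x => x ∉ M.closure (↑I : Set α))) with hP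
  have hPcard : m * ((F.powerset.filter (fun I : Finset α => M.Indep (↑I : Set α) ∧ I.card = i))).card ≤ P.card := by
    rw [hP, Finset.card_sigma, mul_comm]
    have := Finset.card_nsmul_le_sum ((F.powerset.filter (fun I : Finset α => M.Indep (↑I : Set α) ∧ I.card = i)))
      (fun I => (F.filter (fun x => x ∉ M.closure (↑I : Set α))).card) m (fun I hI => hm I hI)
    simpa [smul_eq_mul] using this
  have hmemP : ∀ a ∈ P, a.1 ∈ (F.powerset.filter (fun I : Finset α => M.Indep (↑I : Set α) ∧ I.card = i)) ∧ a.2 ∈ F ∧ a.2 ∉ M.closure (↑a.1 : Set α) := by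
    rintro ⟨I, x⟩ haP
    rw [hP, Finset.mem_sigma] at haP
    obtain ⟨h1, h2⟩ := haP
    rw [Finset.mem_filter] at h2
    exact ⟨h1, h2.1, h2.2⟩
  have hmaps : ∀ a ∈ P, insert a.2 a.1 ∈ (F.powerset.filter (fun I : Finset α => M.Indep (↑I : Set α) ∧ I.card = (i + 1))) := by
    rintro ⟨I, x⟩ haP
    obtain ⟨hI, hxF, hxcl⟩ := hmemP ⟨I, x⟩ haP
    simp only at hI hxF hxcl
    rw [mem_indepSets] at hI
    obtain ⟨hIF, hIind, hIcard⟩ := hI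
    have hIE : (↑I : Set α) ⊆ M.E := (Finset.coe_subset.2 hIF).trans hF
    have hxI : x ∉ I := fun h => hxcl (M.mem_closure_of_mem (Finset.mem_coe.2 h) hIE)
    rw [mem_indepSets]
    refine ⟨Finset.insert_subset hxF hIF, ?_, by rw [Finset.card_insert_of_notMem hxI, hIcard]⟩
    rw [Finset.coe_insert]
    exact (hIind.insert_indep_iff_of_notMem (fun h => hxI (Finset.mem_coe.1 h))).2 ⟨hF hxF, hxcl⟩
  have hfib : ∀ J ∈ (F.powerset.filter (fun I : Finset α => M.Indep (↑I : Set α) ∧ I.card = (i + 1))), (P.filter (fun a => insert a.2 a.1 = J)).card ≤ i + 1 := by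
    intro J hJ
    rw [mem_indepSets] at hJ
    obtain ⟨-, -, hJcard⟩ := hJ
    rw [← hJcard]
    refine Finset.card_le_card_of_injOn (fun a => a.2) ?_ ?_
    · intro a ha
      rw [Finset.mem_coe, Finset.mem_filter] at ha
      rw [Finset.mem_coe, ← ha.2]
      exact Finset.mem_insert_self _ _
    · rintro ⟨I, x⟩ ha ⟨I', x'⟩ ha' hxx'
      simp only at hxx'
      subst hxx'
      rw [Finset.mem_coe, Finset.mem_filter] at ha ha'
      obtain ⟨-, hxF, hxcl⟩ := hmemP _ ha.1
      obtain ⟨-, -, hxcl'⟩ := hmemP _ ha'.1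
      simp only at hxcl hxcl' ha ha'
      have hxI : x ∉ I := fun h => hxcl (M.mem_closure_of_mem (Finset.mem_coe.2 h)
        ((Finset.coe_subset.2 (mem_indepSets.1 (hmemP _ ha.1).1).1).trans hF))
      have hxI' : x ∉ I' := fun h => hxcl' (M.mem_closure_of_mem (Finset.mem_coe.2 h)
        ((Finset.coe_subset.2 (mem_indepSets.1 (hmemP _ ha'.1).1).1).trans hF))
      have hII' : I = I' := by
        rw [← Finset.erase_insert hxI, ← Finset.erase_insert hxI', ha.2, ha'.2]
      subst hII'
      rfl
  have := Finset.card_le_mul_card_image_of_maps_to hmaps (i + 1) hfib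
  exact hPcard.trans this

/-- **THE EXTENSIONS.** An independent `i`-set `I` inside a set `F` of rank `> i` whose closure has `≤ f` points
leaves at least `max(|F| − f, 1)` points of `F` outside `cl I`. -/
theorem card_filter_notMem_closure_ge (M : Matroid α) [M.Finite] (F : Finset α)
    (I : Finset α) (hIind : M.Indep (↑I : Set α)) (i : ℕ) (hIcard : I.card = i)
    (hr : (i : ℕ∞) < M.eRk (↑F : Set α)) (f : ℕ) (hf : (M.closure (↑I : Set α)).ncard ≤ f) :
    max (F.card - f) 1 ≤ (F.filter (fun x => x ∉ M.closure (↑I : Set α))).card := by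
  have hin : (F.filter (fun x => x ∈ M.closure (↑I : Set α))).card ≤ f := by
    calc (F.filter (fun x => x ∈ M.closure (↑I : Set α))).card
        = ((↑(F.filter (fun x => x ∈ M.closure (↑I : Set α))) : Set α)).ncard :=
          (Set.ncard_coe_finset _).symm
      _ ≤ (M.closure (↑I : Set α)).ncard := by
          refine Set.ncard_le_ncard ?_ (M.ground_finite.subset (M.closure_subset_ground _))
          intro x hx
          rw [Finset.mem_coe, Finset.mem_filter] at hx
          exact hx.2
      _ ≤ f := hf
  have hsplit := Finset.card_filter_add_card_filter_not (s := F) (fun x => x ∈ M.closure (↑I : Set α))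
  have hne : (F.filter (fun x => x ∉ M.closure (↑I : Set α))).Nonempty := by
    by_contra hcon
    rw [Finset.not_nonempty_iff_eq_empty, Finset.filter_eq_empty_iff] at hcon
    have hsub : (↑F : Set α) ⊆ M.closure (↑I : Set α) := fun x hx => by
      have := hcon (Finset.mem_coe.1 hx)
      simpa using this
    have h1 : M.eRk (↑F : Set α) ≤ M.eRk (M.closure (↑I : Set α)) := M.eRk_mono hsub
    rw [M.eRk_closure_eq, hIind.eRk_eq_encard, Set.encard_coe_eq_coe_finsetCard, hIcard] at h1
    exact absurd h1 (not_le.2 hr)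
  have hpos : 1 ≤ (F.filter (fun x => x ∉ M.closure (↑I : Set α))).card := Finset.card_pos.2 hne
  rw [max_le_iff]
  constructor <;> omega

/-- **THE GREEDY BASIS COUNT.** If every set of rank `≤ i` has `≤ f i` points (`i < r`), a finset `F ⊆ E` of rank
`≥ r` has at least `∏_{i<r} max(|F| − f i, 1) / r!` independent `r`-subsets. -/
theorem prod_le_factorial_mul_card_indepSets (M : Matroid α) [M.Finite] (F : Finset α)
    (hF : (↑F : Set α) ⊆ M.E) (r : ℕ) (hr : (r : ℕ∞) ≤ M.eRk (↑F : Set α)) (f : ℕ → ℕ)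
    (hf : ∀ i < r, ∀ X ⊆ M.E, M.eRk X ≤ (i : ℕ∞) → X.ncard ≤ f i) :
    ∏ i ∈ Finset.range r, max (F.card - f i) 1 ≤ r.factorial * ((F.powerset.filter (fun I : Finset α => M.Indep (↑I : Set α) ∧ I.card = r))).card := by
  induction r with
  | zero => rw [indepSets_zero]; simp
  | succ r ih =>
    have hr' : (r : ℕ∞) ≤ M.eRk (↑F : Set α) :=
      le_trans (by exact_mod_cast Nat.le_succ r) hr
    have ih' := ih hr' (fun i hi => hf i (Nat.lt_succ_of_lt hi))
    have hstep := card_indepSets_mul_le M F hF r (max (F.card - f r) 1) (fun I hI => by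
      rw [mem_indepSets] at hI
      obtain ⟨-, hIind, hIcard⟩ := hI
      refine card_filter_notMem_closure_ge M F I hIind r hIcard ?_ (f r) ?_
      · exact lt_of_lt_of_le (by exact_mod_cast Nat.lt_succ_self r) hr
      · refine hf r (Nat.lt_succ_self r) _ (M.closure_subset_ground _) ?_
        rw [M.eRk_closure_eq, hIind.eRk_eq_encard, Set.encard_coe_eq_coe_finsetCard, hIcard])
    rw [Finset.prod_range_succ, Nat.factorial_succ]
    calc (∏ i ∈ Finset.range r, max (F.card - f i) 1) * max (F.card - f r) 1
        ≤ (r.factorial * ((F.powerset.filter (fun I : Finset α => M.Indep (↑I : Set α) ∧ I.card = r))).card) * max (F.card - f r) 1 := Nat.mul_le_mul_right _ ih'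
      _ = r.factorial * (max (F.card - f r) 1 * ((F.powerset.filter (fun I : Finset α => M.Indep (↑I : Set α) ∧ I.card = r))).card) := by ring
      _ ≤ r.factorial * ((r + 1) * ((F.powerset.filter (fun I : Finset α => M.Indep (↑I : Set α) ∧ I.card = (r + 1)))).card) := Nat.mul_le_mul_left _ hstep
      _ = (r + 1) * r.factorial * ((F.powerset.filter (fun I : Finset α => M.Indep (↑I : Set α) ∧ I.card = (r + 1)))).card := by ring

/-- **THE PER-FLAT BOUND.** `I₀ ⊆ E` independent with `j` points, `F = cl I₀` with `s ≤ f j` points, every set of rank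
`≤ i` (`i < j`) of `≤ f i` points, and `j!·2^s ≤ g · ∏_{i<j} max(s − f i, 1)` give `2^{|F|} ≤ g · #{I' : I' ⊆ E independent,
|I'| = j, cl I' = F}` — the fibre of `cl` over `F` contains every independent `j`-subset of `F`. -/
theorem two_pow_le_mul_card_fibre (M : Matroid α) [M.Finite] (j : ℕ) (f : ℕ → ℕ) (g : ℕ)
    (hf : ∀ i < j, ∀ X ⊆ M.E, M.eRk X ≤ (i : ℕ∞) → X.ncard ≤ f i)
    (hg : ∀ s, j ≤ s → s ≤ f j → j.factorial * 2 ^ s ≤ g * ∏ i ∈ Finset.range j, max (s - f i) 1)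
    (𝓘 : Finset (Set α)) (h𝓘 : ∀ I, I ∈ 𝓘 ↔ I ⊆ M.E ∧ M.Indep I ∧ I.ncard = j)
    (I₀ : Set α) (hI₀ : I₀ ∈ 𝓘) (hcl : (M.closure I₀).ncard ≤ f j) :
    2 ^ (M.closure I₀).ncard ≤ g * (𝓘.filter (fun I => M.closure I = M.closure I₀)).card := by
  obtain ⟨hI₀E, hI₀ind, hI₀card⟩ := (h𝓘 I₀).1 hI₀
  have hFfin : (M.closure I₀).Finite := M.ground_finite.subset (M.closure_subset_ground _)
  set F : Finset α := hFfin.toFinset with hFdef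
  have hFcoe : (↑F : Set α) = M.closure I₀ := by rw [hFdef, Set.Finite.coe_toFinset]
  have hFcard : F.card = (M.closure I₀).ncard := by
    rw [← Set.ncard_coe_finset F, hFcoe]
  have hFE : (↑F : Set α) ⊆ M.E := by rw [hFcoe]; exact M.closure_subset_ground _
  have hI₀fin : I₀.Finite := M.ground_finite.subset hI₀E
  have hrank : M.eRk (↑F : Set α) = (j : ℕ∞) := by
    rw [hFcoe, M.eRk_closure_eq, hI₀ind.eRk_eq_encard, ← hI₀fin.cast_ncard_eq, hI₀card]
  -- the greedy count on `F`
  have hprod := prod_le_factorial_mul_card_indepSets M F hFE j (le_of_eq hrank.symm) f hf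
  -- `j ≤ |F| ≤ f j`
  have hsle : F.card ≤ f j := by rw [hFcard]; exact hcl
  have hjs : j ≤ F.card := by
    rw [hFcard, ← hI₀card]
    exact Set.ncard_le_ncard (M.subset_closure I₀ hI₀E) hFfin
  have hnum := hg F.card hjs hsle
  -- the independent `j`-subsets of `F` inject into the fibre
  have hinj : ((F.powerset.filter (fun I : Finset α => M.Indep (↑I : Set α) ∧ I.card = j))).card ≤ (𝓘.filter (fun I => M.closure I = M.closure I₀)).card := by
    refine Finset.card_le_card_of_injOn (fun I => (↑I : Set α)) ?_ ?_
    · intro I hI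
      rw [Finset.mem_coe, mem_indepSets] at hI
      obtain ⟨hIF, hIind, hIcard⟩ := hI
      rw [Finset.mem_coe, Finset.mem_filter, h𝓘]
      have hIsub : (↑I : Set α) ⊆ M.closure I₀ := by rw [← hFcoe]; exact Finset.coe_subset.2 hIF
      refine ⟨⟨hIsub.trans (M.closure_subset_ground _), hIind, by rw [Set.ncard_coe_finset, hIcard]⟩, ?_⟩
      -- `I` is a basis of `cl I₀`
      have hb : M.IsBasis (↑I : Set α) (M.closure I₀) := by
        refine hIind.isBasis_of_eRk_ge (Finset.finite_toSet I) hIsub ?_ (M.closure_subset_ground _)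
        rw [M.eRk_closure_eq, hIind.eRk_eq_encard, Set.encard_coe_eq_coe_finsetCard, hIcard,
          hI₀ind.eRk_eq_encard, ← hI₀fin.cast_ncard_eq, hI₀card]
      rw [hb.closure_eq_closure, M.closure_closure]
    · intro I _ I' _ h
      exact Finset.coe_injective h
  -- assemble: `j! · 2^s ≤ g · ∏ ≤ g · j! · #indepSets ≤ g · j! · #fibre`
  have hfac : 0 < j.factorial := Nat.factorial_pos j
  have h2 : j.factorial * 2 ^ F.card ≤ j.factorial * (g * (𝓘.filter (fun I => M.closure I = M.closure I₀)).card) := by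
    calc j.factorial * 2 ^ F.card ≤ g * ∏ i ∈ Finset.range j, max (F.card - f i) 1 := hnum
      _ ≤ g * (j.factorial * ((F.powerset.filter (fun I : Finset α => M.Indep (↑I : Set α) ∧ I.card = j))).card) := Nat.mul_le_mul_left _ hprod
      _ ≤ g * (j.factorial * (𝓘.filter (fun I => M.closure I = M.closure I₀)).card) :=
          Nat.mul_le_mul_left _ (Nat.mul_le_mul_left _ hinj)
      _ = j.factorial * (g * (𝓘.filter (fun I => M.closure I = M.closure I₀)).card) := by ring
  rw [← hFcard]
  exact Nat.le_of_mul_le_mul_left h2 hfac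

/-- **THE RANK-`≤ q` COUNT, FLAT BY FLAT.** If every set of rank `≤ j` has `≤ f j` points and
`j!·2^s ≤ g j · ∏_{i<j} max(s − f i, 1)` for every `j ≤ s ≤ f j` (`j ≤ q`), then
`#{X ⊆ E : ρ(X) ≤ q} ≤ Σ_{j ≤ q} C(n, j) · g j`: every such `X` lies in the powerset of its closure, a flat of rank
`j = ρ(X)`, and the powersets of the rank-`j` flats are charged flat by flat to their bases. -/
theorem ncard_eRk_le_le_sum_choose_flats (M : Matroid α) [M.Finite] (q : ℕ) (f g : ℕ → ℕ)
    (hf : ∀ j ≤ q, ∀ X ⊆ M.E, M.eRk X ≤ (j : ℕ∞) → X.ncard ≤ f j)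
    (hg : ∀ j ≤ q, ∀ s, j ≤ s → s ≤ f j → j.factorial * 2 ^ s ≤ g j * ∏ i ∈ Finset.range j, max (s - f i) 1) :
    {X : Set α | X ⊆ M.E ∧ M.eRk X ≤ (q : ℕ∞)}.ncard ≤
      ∑ j ∈ Finset.range (q + 1), M.E.ncard.choose j * g j := by
  -- the independent `j`-sets as finsets
  have hfinI : ∀ j : ℕ, {I : Set α | I ⊆ M.E ∧ M.Indep I ∧ I.ncard = j}.Finite :=
    fun j => M.ground_finite.finite_subsets.subset (fun I hI => hI.1)
  set 𝓘 : ℕ → Finset (Set α) := fun j => (hfinI j).toFinset with h𝓘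
  have hmem𝓘 : ∀ j I, I ∈ 𝓘 j ↔ I ⊆ M.E ∧ M.Indep I ∧ I.ncard = j := by
    intro j I
    rw [h𝓘, Set.Finite.mem_toFinset]
    rfl
  -- the cover by the powersets of the closures
  have hcover : {X : Set α | X ⊆ M.E ∧ M.eRk X ≤ (q : ℕ∞)} ⊆
      ⋃ j ∈ Finset.range (q + 1), ⋃ I ∈ 𝓘 j, 𝒫 (M.closure I) := by
    rintro X ⟨hXE, hXq⟩
    obtain ⟨I, hI⟩ := M.exists_isBasis X hXE
    have hIX : I ⊆ X := hI.subset
    have hIE : I ⊆ M.E := hIX.trans hXE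
    have hIfin : I.Finite := M.ground_finite.subset hIE
    have hIcard : (I.ncard : ℕ∞) = M.eRk X := by
      rw [← hI.encard_eq_eRk, hIfin.cast_ncard_eq]
    have hIq : I.ncard ≤ q := by
      have : (I.ncard : ℕ∞) ≤ (q : ℕ∞) := hIcard ▸ hXq
      exact_mod_cast this
    simp only [Set.mem_iUnion, Finset.mem_range, exists_prop]
    refine ⟨I.ncard, by omega, I, ?_, hI.subset_closure⟩
    rw [hmem𝓘]
    exact ⟨hIE, hI.indep, rfl⟩
  have hfinU : (⋃ j ∈ Finset.range (q + 1), ⋃ I ∈ 𝓘 j, 𝒫 (M.closure I)).Finite := by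
    refine (Finset.range (q + 1)).finite_toSet.biUnion (fun j _ => ?_)
    refine (𝓘 j).finite_toSet.biUnion (fun I _ => ?_)
    exact M.ground_finite.finite_subsets.subset
      (fun X hX => ((Set.mem_powerset_iff _ _).1 hX).trans (M.closure_subset_ground I))
  calc {X : Set α | X ⊆ M.E ∧ M.eRk X ≤ (q : ℕ∞)}.ncard
      ≤ (⋃ j ∈ Finset.range (q + 1), ⋃ I ∈ 𝓘 j, 𝒫 (M.closure I)).ncard :=
        ncard_le_ncard hcover hfinU
    _ ≤ ∑ j ∈ Finset.range (q + 1), (⋃ I ∈ 𝓘 j, 𝒫 (M.closure I)).ncard :=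
        Finset.set_ncard_biUnion_le _ _
    _ ≤ ∑ j ∈ Finset.range (q + 1), M.E.ncard.choose j * g j := by
        refine Finset.sum_le_sum (fun j hj => ?_)
        have hjq : j ≤ q := by
          have := Finset.mem_range.1 hj
          omega
        -- group by the flats `F = cl I`
        have hgroup : (⋃ I ∈ 𝓘 j, 𝒫 (M.closure I)) = ⋃ F ∈ (𝓘 j).image M.closure, 𝒫 F :=
          (Finset.set_biUnion_finset_image (f := M.closure) (g := fun F => 𝒫 F) (s := 𝓘 j)).symm
        rw [hgroup]
        calc (⋃ F ∈ (𝓘 j).image M.closure, 𝒫 F).ncard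
            ≤ ∑ F ∈ (𝓘 j).image M.closure, (𝒫 F).ncard := Finset.set_ncard_biUnion_le _ _
          _ ≤ ∑ F ∈ (𝓘 j).image M.closure, g j * ((𝓘 j).filter (fun I => M.closure I = F)).card := by
              refine Finset.sum_le_sum (fun F hF => ?_)
              obtain ⟨I₀, hI₀, rfl⟩ := Finset.mem_image.1 hF
              have hFfin : (M.closure I₀).Finite := M.ground_finite.subset (M.closure_subset_ground _)
              rw [Set.ncard_powerset _ hFfin]
              obtain ⟨hI₀E, hI₀ind, hI₀card⟩ := (hmem𝓘 j I₀).1 hI₀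
              have hI₀fin : I₀.Finite := M.ground_finite.subset hI₀E
              refine two_pow_le_mul_card_fibre M j f (g j) (fun i hi => hf i (by omega)) (hg j hjq) (𝓘 j)
                (hmem𝓘 j) I₀ hI₀ ?_
              refine hf j hjq _ (M.closure_subset_ground _) ?_
              rw [M.eRk_closure_eq, hI₀ind.eRk_eq_encard, ← hI₀fin.cast_ncard_eq, hI₀card]
          _ = g j * (𝓘 j).card := by
              rw [← Finset.mul_sum, ← Finset.card_eq_sum_card_image M.closure (𝓘 j)]
          _ ≤ M.E.ncard.choose j * g j := by
              rw [mul_comm]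
              refine Nat.mul_le_mul_right _ ?_
              have hcard : (𝓘 j).card = {I : Set α | I ⊆ M.E ∧ M.Indep I ∧ I.ncard = j}.ncard := by
                rw [h𝓘]
                exact (ncard_eq_toFinset_card _ (hfinI j)).symm
              rw [hcard]
              exact ncard_indep_ncard_eq_le_choose M j

/-- **THE HYPERPLANE KEY FROM A WEIGHTED COUNT AND TWO BASE VALUES.** `e`-free, `ρ(E) = p`,
`#{ρ ≤ q} ≤ Σ_{j ≤ q} C(n, j)·w j`, `n ≥ n₀ ≥ 4q`, and `(Φ(p,q) + 1)·Σ_{j ≤ q} C(m, j)·w j ≤ 2^{⌊m/2⌋}` at `m = n₀`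
and `m = n₀ + 1` give `ThmN.RLS M p q`. -/
theorem rls_of_hyperplane_key_two_base_weighted (M : Matroid α) [M.Finite] (p q : ℕ) (hR : M.eRank = (p : ℕ∞))
    (hfree : ∀ e ∈ M.E, ∃ A ⊆ M.E \ {e}, e ∉ M.closure A ∧ e ∉ M.closure ((M.E \ {e}) \ A))
    (w : ℕ → ℕ)
    (hcount : {X : Set α | X ⊆ M.E ∧ M.eRk X ≤ (q : ℕ∞)}.ncard ≤ ∑ j ∈ Finset.range (q + 1), M.E.ncard.choose j * w j)
    (n₀ : ℕ) (h4 : 4 * q ≤ n₀) (hn : n₀ ≤ M.E.ncard)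
    (h0 : (phiK p q + 1) * ∑ j ∈ Finset.range (q + 1), (n₀.choose j : ℚ) * (w j : ℚ) ≤ (2 : ℚ) ^ (n₀ / 2))
    (h1 : (phiK p q + 1) * ∑ j ∈ Finset.range (q + 1), ((n₀ + 1).choose j : ℚ) * (w j : ℚ) ≤
      (2 : ℚ) ^ ((n₀ + 1) / 2)) :
    ThmN.RLS M p q := by
  have hcapq : ({X : Set α | X ⊆ M.E ∧ M.eRk X ≤ (q : ℕ∞)}.ncard : ℚ) ≤
      ∑ j ∈ Finset.range (q + 1), (M.E.ncard.choose j : ℚ) * (w j : ℚ) := by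
    exact_mod_cast hcount
  refine rls_of_hyperplane_key M p q hR hfree _ hcapq ?_
  have hΦ : 0 ≤ phiK p q + 1 := by linarith [phiK_nonneg p q]
  refine key_of_two_base (fun m => (phiK p q + 1) * ∑ j ∈ Finset.range (q + 1),
    (m.choose j : ℚ) * (w j : ℚ)) n₀ (fun m hm => ?_) h0 h1 M.E.ncard hn
  have := sum_choose_mul_add_two_le q m (fun j => (w j : ℚ)) (fun j => by positivity) (le_trans h4 hm)
  nlinarith [this, hΦ]

end HypKey

end PercRepro
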